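import Summits.AtomisticToContinuum.HydrodynamicLimit.Theorems.ImplosionDichotomyPolynomialCompressionUniquenessSmoothEos

/-!
# Uniqueness of classical hard-sphere Euler solutions at small packing (analytic equation of state)

Helper file for the line `log-lipschitz-budget` of the crux
`ImplosionDichotomy.PolynomialCompression` (stmt-AtomisticToContinuum-12587), stub
`stub_conditionalExistence`: that stub (Kato/Majda existence on a prescribed horizon from a-priori
bounds) decomposes into (a) local existence, (b) continuation and (c) UNIQUENESS of classical
solutions, glued by the landed soft lemma `isHardSphereEulerSolution_exists_of_apriori`
(`…Continuation.lean`). This file lands (c) under exactly the unbundled equation-of-state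
hypotheses of the stub — `η₀ > 0`, `F` analytic on `(-η₀, η₀)`, `hsExcessFreeEnergy = F` on
`[0, η₀)` (the normalisations `F 0 = 0`, `F'(0) = 2π/3` are not needed): there is a packing
threshold `η₁ > 0` (depending on `η₀, F` only) such that for every reduced diameter `σ > 0`
two classical solutions on `[0, T) × 𝕋³` with packing `ρσ³ ≤ η₁` and equal data at `t = 0`
coincide on `[0, T)` (`hsEuler_unique_of_analytic_eos`). Proof: the compressibility factor is
`Z(η) = 1 + η F'(η)` on `(0, η₀)`, smooth on `(-η₀, η₀)`, with `Z + ηZ' → 1` as `η → 0`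
(hyperbolicity `∂p/∂ρ = θ(Z + ηZ') > 0` at small packing); apply the smooth-law uniqueness theorem
`hsEuler_unique_of_smooth_eos` (`…UniquenessSmoothEos.lean`) with `ζ(r) = Z(rσ³)`.
-/

noncomputable section

namespace Summit.AtomisticToContinuum.HydrodynamicLimit.Theorems

open Set Filter Topology MeasureTheory
open scoped ContDiff
open Literature.MathematicalPhysics.KineticTheory Literature.Analysis.FunctionSpaces

/-- Under `hsExcessFreeEnergy = F` on `[0, η₀)`, the compressibility factor is `1 + η F'(η)` on
`(0, η₀)` (the two functions agree near `η`, so their derivatives agree). [folklore] -/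
theorem hsCompressibility_eq_of_eqOn {η₀ : ℝ} {F : ℝ → ℝ}
    (hEq : EqOn hsExcessFreeEnergy F (Ico 0 η₀)) {η : ℝ} (hη : η ∈ Ioo 0 η₀) :
    hsCompressibility η = 1 + η * deriv F η := by
  have hnhds : hsExcessFreeEnergy =ᶠ[𝓝 η] F :=
    hEq.eventuallyEq_of_mem (mem_of_superset (Ioo_mem_nhds hη.1 hη.2) Ioo_subset_Ico_self)
  show 1 + η * deriv hsExcessFreeEnergy η = 1 + η * deriv F η
  rw [hnhds.deriv_eq]

/-- **Uniqueness of classical hard-sphere Euler solutions at small packing** (component (c) of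
`stub_conditionalExistence`). If the hard-sphere excess free energy agrees on `[0, η₀)` with a
function `F` analytic on `(-η₀, η₀)`, there is `η₁ > 0` such that for every reduced diameter
`σ > 0` and every horizon `T`, two classical solutions `(ρ, u, θ)`, `(ρ', u', θ')` of the
hard-sphere Euler system on `[0, T) × 𝕋³` with packing fractions `ρσ³, ρ'σ³ ≤ η₁` and equal
density, velocity and temperature at `t = 0` coincide on `[0, T)`: the system is symmetrisable
hyperbolic at small packing (`Z(η) + ηZ'(η) → 1`), and the relative-energy method with Grönwall's
lemma on `𝕋³` applies (`hsEuler_unique_of_smooth_eos`). [folklore] -/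
theorem hsEuler_unique_of_analytic_eos :
    ∀ η₀ : ℝ, 0 < η₀ → ∀ F : ℝ → ℝ, AnalyticOnNhd ℝ F (Ioo (-η₀) η₀) →
      EqOn hsExcessFreeEnergy F (Ico 0 η₀) →
      ∃ η₁ : ℝ, 0 < η₁ ∧ ∀ σ : ℝ, 0 < σ →
        ∀ (T : ℝ) (ρ θ : ℝ → T3 → ℝ) (u : ℝ → T3 → V3) (ρ' θ' : ℝ → T3 → ℝ) (u' : ℝ → T3 → V3),
          IsHardSphereEulerSolution σ T ρ u θ → IsHardSphereEulerSolution σ T ρ' u' θ' →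
          (∀ t ∈ Ico 0 T, ∀ x, ρ t x * σ ^ 3 ≤ η₁) → (∀ t ∈ Ico 0 T, ∀ x, ρ' t x * σ ^ 3 ≤ η₁) →
          ρ 0 = ρ' 0 → u 0 = u' 0 → θ 0 = θ' 0 →
          ∀ t ∈ Ico 0 T, ρ t = ρ' t ∧ u t = u' t ∧ θ t = θ' t := by
  intro η₀ hη₀ F hF hEq
  obtain ⟨Zf, hZf⟩ : ∃ Zf : ℝ → ℝ, Zf = fun η => 1 + η * deriv F η := ⟨_, rfl⟩
  have hFc : ContDiffOn ℝ ∞ F (Ioo (-η₀) η₀) := hF.contDiffOn_of_completeSpace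
  have hZc : ContDiffOn ℝ ∞ Zf (Ioo (-η₀) η₀) := by
    rw [hZf]
    exact contDiffOn_const.add (contDiffOn_id.mul (hFc.deriv_of_isOpen (m := ∞) isOpen_Ioo le_rfl))
  have hZd : ContDiffOn ℝ ∞ (deriv Zf) (Ioo (-η₀) η₀) := hZc.deriv_of_isOpen isOpen_Ioo le_rfl
  have h0mem : (0 : ℝ) ∈ Ioo (-η₀) η₀ := ⟨by linarith, hη₀⟩
  -- hyperbolicity near packing `0`: `Z + ηZ'` is continuous at `0` with value `1`
  have hgc : ContinuousAt (fun η => Zf η + η * deriv Zf η) 0 :=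
    (hZc.continuousOn.continuousAt (isOpen_Ioo.mem_nhds h0mem)).add
      (continuousAt_id.mul (hZd.continuousOn.continuousAt (isOpen_Ioo.mem_nhds h0mem)))
  have hg0 : Zf 0 + 0 * deriv Zf 0 = 1 := by simp [hZf]
  have hev : ∀ᶠ η in 𝓝 (0 : ℝ), 1 / 2 < Zf η + η * deriv Zf η := by
    have h : (fun η => Zf η + η * deriv Zf η) ⁻¹' Ioi (1 / 2) ∈ 𝓝 (0 : ℝ) := by
      refine hgc.preimage_mem_nhds ?_
      show Ioi (1 / 2 : ℝ) ∈ 𝓝 (Zf 0 + 0 * deriv Zf 0)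
      rw [hg0]
      exact Ioi_mem_nhds (by norm_num)
    exact h
  obtain ⟨δ, hδ, hδg⟩ := Metric.eventually_nhds_iff.1 hev
  refine ⟨min (η₀ / 2) (δ / 2), by positivity, ?_⟩
  intro σ hσ T ρ θ u ρ' θ' u' hE hE' hpk hpk' h0 hu0 hθ0
  have hσ3 : 0 < σ ^ 3 := pow_pos hσ 3
  have hη₁η₀ : min (η₀ / 2) (δ / 2) < η₀ := (min_le_left _ _).trans_lt (by linarith)
  have hη₁δ : min (η₀ / 2) (δ / 2) < δ := (min_le_right _ _).trans_lt (by linarith)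
  -- the rescaled law `ζ(r) = Z(rσ³)` on `J = {r | rσ³ ∈ (-η₀, η₀)}`
  have hJo : IsOpen ((fun r : ℝ => r * σ ^ 3) ⁻¹' Ioo (-η₀) η₀) :=
    isOpen_Ioo.preimage (continuous_id.mul continuous_const)
  have hζ : ContDiffOn ℝ ∞ (fun r => Zf (r * σ ^ 3)) ((fun r : ℝ => r * σ ^ 3) ⁻¹' Ioo (-η₀) η₀) :=
    hZc.comp (contDiffOn_id.mul contDiffOn_const) fun r hr => hr
  have hab : Icc 0 (min (η₀ / 2) (δ / 2) / σ ^ 3) ⊆ (fun r : ℝ => r * σ ^ 3) ⁻¹' Ioo (-η₀) η₀ := by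
    intro r hr
    have h1 : 0 ≤ r * σ ^ 3 := mul_nonneg hr.1 hσ3.le
    have h2 : r * σ ^ 3 ≤ min (η₀ / 2) (δ / 2) := (le_div_iff₀ hσ3).1 hr.2
    exact ⟨by linarith, by linarith⟩
  have hγ : ∀ r ∈ Icc 0 (min (η₀ / 2) (δ / 2) / σ ^ 3),
      0 < (fun r => Zf (r * σ ^ 3)) r + r * deriv (fun r => Zf (r * σ ^ 3)) r := by
    intro r hr
    have h1 : 0 ≤ r * σ ^ 3 := mul_nonneg hr.1 hσ3.le
    have h2 : r * σ ^ 3 ≤ min (η₀ / 2) (δ / 2) := (le_div_iff₀ hσ3).1 hr.2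
    have hmem : r * σ ^ 3 ∈ Ioo (-η₀) η₀ := hab hr
    have hd : HasDerivAt (fun r => Zf (r * σ ^ 3)) (deriv Zf (r * σ ^ 3) * σ ^ 3) r := by
      have hz : HasDerivAt Zf (deriv Zf (r * σ ^ 3)) (r * σ ^ 3) :=
        ((hZc.differentiableOn (by simp)).differentiableAt (isOpen_Ioo.mem_nhds hmem)).hasDerivAt
      have hl : HasDerivAt (fun r : ℝ => r * σ ^ 3) (σ ^ 3) r := by
        simpa using (hasDerivAt_id r).mul_const (σ ^ 3)
      exact hz.comp r hl
    have hlt : 1 / 2 < Zf (r * σ ^ 3) + r * σ ^ 3 * deriv Zf (r * σ ^ 3) := by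
      refine hδg ?_
      rw [dist_zero_right, Real.norm_eq_abs, abs_of_nonneg h1]
      linarith
    show 0 < Zf (r * σ ^ 3) + r * deriv (fun r => Zf (r * σ ^ 3)) r
    rw [hd.deriv]
    nlinarith
  -- the pressure fields and the density ranges of the two solutions
  have hp : ∀ t ∈ Ico 0 T, ∀ x,
      hsPressure σ (ρ t x) (θ t x) = ρ t x * θ t x * (fun r => Zf (r * σ ^ 3)) (ρ t x) := by
    intro t ht x
    have hη : ρ t x * σ ^ 3 ∈ Ioo 0 η₀ :=
      ⟨mul_pos (hE.density_pos t ht x) hσ3, (hpk t ht x).trans_lt hη₁η₀⟩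
    show ρ t x * θ t x * hsCompressibility (ρ t x * σ ^ 3) = ρ t x * θ t x * Zf (ρ t x * σ ^ 3)
    rw [hsCompressibility_eq_of_eqOn hEq hη, hZf]
  have hp' : ∀ t ∈ Ico 0 T, ∀ x,
      hsPressure σ (ρ' t x) (θ' t x) = ρ' t x * θ' t x * (fun r => Zf (r * σ ^ 3)) (ρ' t x) := by
    intro t ht x
    have hη : ρ' t x * σ ^ 3 ∈ Ioo 0 η₀ :=
      ⟨mul_pos (hE'.density_pos t ht x) hσ3, (hpk' t ht x).trans_lt hη₁η₀⟩
    show ρ' t x * θ' t x * hsCompressibility (ρ' t x * σ ^ 3) = ρ' t x * θ' t x * Zf (ρ' t x * σ ^ 3)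
    rw [hsCompressibility_eq_of_eqOn hEq hη, hZf]
  have hρab : ∀ t ∈ Ico 0 T, ∀ x, ρ t x ∈ Icc 0 (min (η₀ / 2) (δ / 2) / σ ^ 3) := fun t ht x =>
    ⟨(hE.density_pos t ht x).le, (le_div_iff₀ hσ3).2 (hpk t ht x)⟩
  have hρab' : ∀ t ∈ Ico 0 T, ∀ x, ρ' t x ∈ Icc 0 (min (η₀ / 2) (δ / 2) / σ ^ 3) := fun t ht x =>
    ⟨(hE'.density_pos t ht x).le, (le_div_iff₀ hσ3).2 (hpk' t ht x)⟩
  exact hsEuler_unique_of_smooth_eos hE hE' hJo hζ hab hγ hρab hρab' hp hp' h0 hu0 hθ0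

end Summit.AtomisticToContinuum.HydrodynamicLimit.Theorems

end
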